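import Summits.ResolutionOfSingularities.ResolutionOfSingularities.Theorems.FrobeniusClosingPatchingRelPerfectPointBlowupChartAssembly
import HarnessLib

/-!
# Crux `PatchingRelPerfect` (stmt-ResolutionOfSingularities-16161), chain w52 — CORE RUNG r1f:
# the blow-up-form open core on the products `I = 𝔪 · (z₁, …, z_m)`, `z` part of a regular
# system of parameters (`Bl_I` is already regular)

[OURS · L1 W5.2 · rung] The open core `stub_atomDimFourBlowup` (`AtomDimFourBlowupAt p`) of
skeleton v5.1 restricted to the family **`I = 𝔪 · 𝔞`, `𝔞 = (z₁, …, z_m)` generated by part of a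
regular system of parameters** of the regular local base `S` (the maximal ideal times the ideal of
a regular germ `Z = V(z)` through the closed point; `m = dim S`: `I = 𝔪²`, `m = 1`: `I = z₁ · 𝔪`,
both rung r0 / r1d; in dimension `4` e.g. `I = (x₁,…,x₄)·(x₁,x₂) = (x₁², x₁x₂, x₂², x₁x₃, x₁x₄,
x₂x₃, x₂x₄)`).  Here `T = Bl_I Spec S` is itself REGULAR — so the atom holds with `J = 𝒪_T` —
because `Bl_{𝔪·𝔞} = Bl_{𝔪·𝒪_B} B` for `B = Bl_𝔞 Spec S` (Stacks 080A; `B` regular: regular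
centre), and on the Rees chart `D₊(z_i t) = Spec B_i` of `B` the total transform of `𝔪` is
`(z_i, y₁, …, y_e)` (`map_chartBase_maximal_centre`; `y` the remaining parameters), the ideal of
the fibre `ℙ^{m-1}_κ` of the exceptional divisor `E_Z → Z` over the closed point — a REGULAR
centre (`B_i ⧸ (z_i, y) ≅ κ[T_j : j ≠ i]`, de Jong's chart computation
`isRegularRing_quot_chartIdeal`), so Liu 8.1.19 (a) applies chart by chart and the shared
assembly tool `isRegular_of_isBlowup_mul_of_charts` (`…PointBlowupChartAssembly.lean`, here for
the FIRST blow-up `Bl_𝔞` rather than `Bl_𝔪`) globalises.  Geometrically: blow up `Z`, then the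
fibre of the exceptional divisor over the closed point.

Every regular local `S`, every dimension, every `0 ≤ m ≤ dim S`; no completeness, characteristic
or residue-field hypothesis; "regular off the closed fibre" is automatic.  BC5-type FORMAT
evidence for the core on the stratum of products of the two simplest regular-centre ideals (the
`080A`-product shape (r1b) of CHAIN v1 §2, in its regular-germ form).  NOT covered: `𝔪ᵏ · 𝔞`,
`k ≥ 2` (total transform `(z_i, y)ᵏ` is not a regular centre), general monomial products.
Nothing here is a statement of the manuscript under review.

Results: `map_chartBase_maximal_centre`, `isRegularRing_chartRing_centre`,
`isRegularRing_chartRing_quot_maximal_centre`, `isRegular_of_isBlowup_chart_centre`,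
`isRegular_of_isBlowup_maximal_mul_centre` (coordinates), and the rungs
`isRegular_of_isBlowup_maximalIdeal_mul_span_rsopPart` (`Bl_{𝔪·(z)}` is regular),
`coreRung_maximalIdeal_mul_span_rsopPart`, `atomDimFourBlowupAt_maximalIdeal_mul_span_rsopPart`.

## References

* The Stacks Project, Tags 080A, 0804, 0BIQ. [StacksProject]
* Q. Liu, *Algebraic Geometry and Arithmetic Curves*, OUP 2002, Thm. 8.1.19 (a)–(b). [Liu2002]
* A. J. de Jong, *Smoothness, semi-stability and alterations*, Publ. Math. IHÉS 83 (1996), 2.4.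
  [DeJong1996]
-/

-- `Summit.<Summit>.<Sub>.Theorems` with `Sub = Summit` (single-conjunct summit, D-0017)
set_option linter.dupNamespace false

noncomputable section

open CategoryTheory CategoryTheory.Limits AlgebraicGeometry Literature.AlgebraicGeometry.Resolution

namespace Summit.ResolutionOfSingularities.ResolutionOfSingularities.Theorems

universe u

section Coordinates

variable {S : Type u} [CommRing S] {m e : ℕ} (z : Fin m → S) (y : Fin e → S)

/-- **The total transform of `𝔪 = (z, y)` on the chart `D₊(z_i t)` of `Bl_{(z)} Spec S` is
`(z_i, y₁, …, y_e)`** (`z_j = z_i · e_j` on the chart). [cite: StacksProject, Tag 0804] -/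
theorem map_chartBase_maximal_centre (i : Fin m) :
    (Ideal.span (Set.range (Fin.append z y))).map (chartBase z i) =
      Ideal.ofList (chartBase z i (z i) :: List.ofFn fun k => chartBase z i (y k)) := by
  apply le_antisymm
  · rw [Ideal.map_span, Ideal.span_le]
    rintro _ ⟨_, ⟨a, rfl⟩, rfl⟩
    rw [SetLike.mem_coe]
    induction a using Fin.addCases with
    | left j =>
      rw [Fin.append_left, reesChartBase_apply_eq_mul_chartGen z i j]
      exact Ideal.mul_mem_right _ _ (Ideal.subset_span (by simp))
    | right k =>
      rw [Fin.append_right]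
      exact Ideal.subset_span (by simp)
  · rw [Ideal.ofList, Ideal.span_le]
    intro t ht
    simp only [Set.mem_setOf_eq, List.mem_cons, List.mem_ofFn] at ht
    rcases ht with rfl | ⟨k, rfl⟩
    · refine Ideal.mem_map_of_mem _ (Ideal.subset_span ⟨Fin.castAdd e i, ?_⟩)
      simp
    · refine Ideal.mem_map_of_mem _ (Ideal.subset_span ⟨Fin.natAdd m k, ?_⟩)
      simp

variable [IsRegularLocalRing S]
  (hz : Ideal.span (Set.range (Fin.append z y)) = IsLocalRing.maximalIdeal S)
  (hd : (IsLocalRing.maximalIdeal S).spanFinrank = m + e)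

include hz hd in
/-- The Rees charts of the blow-up of part of a regular system of parameters are regular rings
(tree `isRegularRing_blowupChart`). [cite: Liu2002, Thm. 8.1.19 (a) (affine charts)] -/
theorem isRegularRing_chartRing_centre (i : Fin m) : IsRegularRing (chartRing z i) := by
  haveI : IsRegularRing S := isRegularRing_of_isRegularLocalRing S
  haveI : IsRegularRing (S ⧸ Ideal.span (Set.range z)) := by
    haveI := isRegularLocalRing_quot_centre z y hz hd
    exact isRegularRing_of_isRegularLocalRing _
  exact isRegularRing_blowupChart z i (isQuasiRegular_centre z y hz hd)

include hz hd in
/-- **The centre `(z_i, y)` on the chart `D₊(z_i t)` has regular quotient** `κ[T_j : j ≠ i]` (the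
fibre of the exceptional divisor over the closed point, chart by chart an affine space).
[cite: StacksProject, Tag 0BIQ] -/
theorem isRegularRing_chartRing_quot_maximal_centre (i : Fin m) :
    IsRegularRing (chartRing z i ⧸
      Ideal.ofList (chartBase z i (z i) :: List.ofFn fun k => chartBase z i (y k))) := by
  have h := isRegularRing_quot_chartIdeal z i y hz hd (chartBase z i) (chartGen z i)
    (chartQuotEquiv z i (isQuasiRegular_centre z y hz hd)) (chartQuotMap_C z i) (chartQuotMap_X z i)
    (fun k : Fin 0 => (Fin.elim0 k : {j : Fin m // j ≠ i}))
  have hEq : Ideal.ofList (chartBase z i (z i) ::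
      ((List.ofFn fun k : Fin 0 => chartGen z i (Fin.elim0 k : {j : Fin m // j ≠ i}).1) ++
        List.ofFn fun k => chartBase z i (y k))) =
      Ideal.ofList (chartBase z i (z i) :: List.ofFn fun k => chartBase z i (y k)) := by
    rw [List.ofFn_zero, List.nil_append]
  haveI := h
  exact IsRegularRing.of_ringEquiv (Ideal.quotEquivOfEq hEq)

include hz hd in
/-- **Chart statement**: every blow-up of the chart `Spec B_i` of `Bl_{(z)} Spec S` along the
total transform `𝔪 · B_i = (z_i, y)` is regular (Liu 8.1.19 (a): regular centre in a regular
affine scheme). [cite: Liu2002, Thm. 8.1.19 (a)] -/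
theorem isRegular_of_isBlowup_chart_centre (i : Fin m) {Y : Scheme.{u}}
    {ρ : Y ⟶ Spec (.of (chartRing z i))}
    (hρ : IsBlowup ρ (affineBlowup.idealSheaf
      ((Ideal.span (Set.range (Fin.append z y))).map (chartBase z i)))) :
    Scheme.IsRegular Y := by
  rw [map_chartBase_maximal_centre] at hρ
  haveI := isRegularRing_chartRing_centre z y hz hd i
  haveI := isRegularRing_chartRing_quot_maximal_centre z y hz hd i
  exact isRegular_of_isBlowup_idealSheaf_of_quotient _ hρ

include hz hd in
/-- **`Bl_{𝔪·(z)} Spec S` is regular** (in coordinates): `Bl_{(z)}` followed by the blow-up of the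
total transform of `𝔪`, regular chart by chart; assembled by `isRegular_of_isBlowup_mul_of_charts`.
[cite: StacksProject, Tag 080A] [cite: Liu2002, Thm. 8.1.19 (a)] -/
theorem isRegular_of_isBlowup_maximal_mul_centre {Y : Scheme.{u}} {σ : Y ⟶ Spec (.of S)}
    (hσ : IsBlowup σ (affineBlowup.idealSheaf
      (Ideal.span (Set.range (Fin.append z y)) * Ideal.span (Set.range z)))) :
    Scheme.IsRegular Y :=
  isRegular_of_isBlowup_mul_of_charts z (Ideal.span (Set.range (Fin.append z y)))
    (fun i _ _ hρ => isRegular_of_isBlowup_chart_centre z y hz hd i hρ) hσ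

end Coordinates

/-! ## The rung, coordinate-free -/

/-- **`Bl_{𝔪·(z₁,…,z_m)} Spec S` is a regular scheme** for `S` regular local and `z` part of a
regular system of parameters (any blow-up in the sense of the universal property).
[cite: StacksProject, Tag 080A] [cite: Liu2002, Thm. 8.1.19 (a)] -/
theorem isRegular_of_isBlowup_maximalIdeal_mul_span_rsopPart {S : Type u} [CommRing S]
    [IsRegularLocalRing S] {m : ℕ} {z : Fin m → S} (hz : IsRsopPart z) {T : Scheme.{u}}
    {f : T ⟶ Spec (.of S)}
    (hf : IsBlowup f (affineBlowup.idealSheaf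
      (IsLocalRing.maximalIdeal S * Ideal.span (Set.range z)))) :
    Scheme.IsRegular T := by
  obtain ⟨e, x, hd, hx, hxz⟩ := hz.exists_rsop
  have hz' : z = fun i => x (Fin.castAdd e i) := (funext hxz).symm
  subst hz'
  have happ : Ideal.span (Set.range (Fin.append (fun i => x (Fin.castAdd e i))
      fun k => x (Fin.natAdd m k))) = IsLocalRing.maximalIdeal S := by
    rw [Fin.append_castAdd_natAdd]; exact hx
  refine isRegular_of_isBlowup_maximal_mul_centre (fun i => x (Fin.castAdd e i))
    (fun k => x (Fin.natAdd m k)) happ hd (σ := f) ?_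
  rw [happ]
  exact hf

/-- **CORE RUNG r1f: the blow-up-form open core on the products `I = 𝔪 · (z₁, …, z_m)`**, `z` part
of a regular system of parameters of the regular local base `S` (any dimension): every blow-up
`T = Bl_I Spec S` along `I ≠ 0` is REGULAR, so the conclusion of the core
(`AtomDimFourBlowupAt`-shape: a non-zero fibre-cosupported ideal sheaf with regular blowing up)
holds with `J = 𝒪_T`. BC5-type format evidence; nothing here is a statement of the manuscript.
[cite: StacksProject, Tag 080A] [cite: Liu2002, Thm. 8.1.19 (a)] -/
theorem coreRung_maximalIdeal_mul_span_rsopPart {S : Type u} [CommRing S] [IsRegularLocalRing S]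
    {m : ℕ} {z : Fin m → S} (hz : IsRsopPart z)
    (hI : IsLocalRing.maximalIdeal S * Ideal.span (Set.range z) ≠ ⊥)
    (T : Scheme.{u}) (f : T ⟶ Spec (.of S))
    (hf : IsBlowup f (affineBlowup.idealSheaf
      (IsLocalRing.maximalIdeal S * Ideal.span (Set.range z)))) :
    ∃ (J : T.IdealSheafData) (T' : Scheme.{u}) (π : T' ⟶ T), J ≠ ⊥ ∧
      (∀ t : T, t ∈ J.support → f.base t = IsLocalRing.closedPoint S) ∧
      IsBlowup π J ∧ Scheme.IsRegular T' := by
  haveI : IsDomain S := isDomain_of_isRegularLocalRing S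
  haveI : IsDomain (CommRingCat.of S) := ‹IsDomain S›
  haveI : IsIntegral T := hf.isIntegral (affineBlowup.idealSheaf_ne_bot hI)
  exact atomConclusion_of_isRegular f (isRegular_of_isBlowup_maximalIdeal_mul_span_rsopPart hz hf)

/-- **The registered core's binder shape, restricted to the family** `I = 𝔪 · (z)` (hypotheses
of `stub_atomDimFourBlowup`; the dimension, characteristic, completeness, residue-field and
off-fibre hypotheses are not used). [cite: StacksProject, Tag 080A] [cite: Liu2002, Thm. 8.1.19 (a)] -/
theorem atomDimFourBlowupAt_maximalIdeal_mul_span_rsopPart (p : ℕ) (_hp : p.Prime) (S : Type)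
    [CommRing S] [IsRegularLocalRing S] [CharP S p]
    [IsAdicComplete (IsLocalRing.maximalIdeal S) S]
    [PerfectField (IsLocalRing.ResidueField S)] (_hS : ringKrullDim S = (4 : ℕ))
    {m : ℕ} {z : Fin m → S} (hz : IsRsopPart z)
    (hI : IsLocalRing.maximalIdeal S * Ideal.span (Set.range z) ≠ ⊥)
    (T : Scheme.{0}) (f : T ⟶ Spec (.of S))
    (hf : IsBlowup f (affineBlowup.idealSheaf
      (IsLocalRing.maximalIdeal S * Ideal.span (Set.range z))))
    (_hoff : ∀ t : T, f.base t ≠ IsLocalRing.closedPoint S →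
      IsRegularLocalRing (T.presheaf.stalk t)) :
    ∃ (J : T.IdealSheafData) (T' : Scheme.{0}) (π : T' ⟶ T), J ≠ ⊥ ∧
      (∀ t : T, t ∈ J.support → f.base t = IsLocalRing.closedPoint S) ∧
      IsBlowup π J ∧ Scheme.IsRegular T' :=
  coreRung_maximalIdeal_mul_span_rsopPart hz hI T f hf

/-- **Non-vanishing**: `𝔪 · (z) ≠ 0` for `m ≥ 1` (a regular local ring is a domain and the `zᵢ`
are members of a minimal basis of `𝔪`, hence non-zero). [folklore] -/
theorem maximalIdeal_mul_span_ne_bot {S : Type u} [CommRing S] [IsRegularLocalRing S]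
    {m : ℕ} {z : Fin m → S} (hz : IsRsopPart z) (hm : 0 < m) :
    IsLocalRing.maximalIdeal S * Ideal.span (Set.range z) ≠ ⊥ := by
  haveI : IsDomain S := isDomain_of_isRegularLocalRing S
  have hz0 : z ⟨0, hm⟩ ≠ 0 := hz.ne_zero ⟨0, hm⟩
  have hspan : Ideal.span (Set.range z) ≠ ⊥ := fun h =>
    hz0 ((Submodule.eq_bot_iff _).mp h _ (Ideal.subset_span ⟨_, rfl⟩))
  have h𝔪 : IsLocalRing.maximalIdeal S ≠ ⊥ := fun h =>
    hz0 ((Submodule.eq_bot_iff _).mp h _ (hz.mem_maximalIdeal _))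
  exact mul_ne_zero h𝔪 hspan

end Summit.ResolutionOfSingularities.ResolutionOfSingularities.Theorems

end
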